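import Literature.NumberTheory.Automorphic.AdeleQuotientFourier
import HarnessLib

/-!
# Pointwise Fourier inversion on the compact group `𝔸_K ⧸ K`
(Tate, *Fourier analysis in number fields and Hecke's zeta-functions*, Lemma 4.2.2, in
Cassels–Fröhlich (eds.), *Algebraic Number Theory* (1967), Ch. XV, PDF p. 360 of the held copy;
Moeglin–Waldspurger (1995), I.2.10 (3): "By Fourier inversion, we thus have
`(φ_{i-1} - φ_i)(ag) = ∑_{ξ ≠ 0} φ^ξ_{i-1}(ag)`")

Topic `NumberTheory/Automorphic`; sequel to `AdeleQuotientFourier` (the characters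
`ψ_ξ = adeleQuotChar K ξ`, `ξ ∈ K`, of `𝔸_K ⧸ K`, the Haar probability measure `adeleQuotHaar K`,
orthogonality and completeness of the `ψ_ξ`). We PROVE the pointwise inversion theorem for
continuous functions with absolutely summable Fourier coefficients — the one-variable Fourier
expansion along `K\𝔸_K` used, coordinate by coordinate along the unipotent radical, in the proof of
Moeglin–Waldspurger's Lemma I.2.10 (rapid decrease of `φ - φ_P` on Siegel sets):

* `continuous_tsum_mul_adeleQuotChar` — a Fourier series `u ↦ ∑_ξ c_ξ ψ_ξ(u)` with `∑ |c_ξ| < ∞`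
  is continuous; `integral_conj_adeleQuotChar_mul_tsum` — its `η`-th coefficient is `c_η`
  (orthogonality, `integral_tsum`);
* `eq_tsum_integral_mul_adeleQuotChar` — **inversion**: for `f` continuous with
  `∑_ξ |f̂(ξ)| < ∞`, `f̂(ξ) = ∫ conj ψ_ξ · f`, one has `f(v) = ∑_ξ f̂(ξ) ψ_ξ(v)` for every `v`
  (`f` minus the series is continuous with vanishing coefficients, hence zero by completeness,
  `eq_zero_of_forall_integral_conj_adeleQuotChar_mul_eq_zero`); at `v = 0`,
  `apply_zero_eq_tsum_integral`, and **the function minus its constant term**,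
  `apply_zero_sub_integral_eq_tsum` : `f(0) - ∫ f = ∑_{ξ ≠ 0} f̂(ξ)`, with the bound
  `norm_apply_zero_sub_integral_le_tsum` : `‖f(0) - ∫ f‖ ≤ ∑_{ξ ≠ 0} |f̂(ξ)|`;
* `integral_conj_adeleQuotChar_mul_comp_add` — **translation covariance** of the coefficients:
  `∫ conj ψ_ξ(u) f(u + w) du = ψ_ξ(w) f̂(ξ)` (the identity differentiated in I.2.10's integration by
  parts).

## References

* J. Tate, in J. W. S. Cassels, A. Fröhlich (eds.), *Algebraic Number Theory* (1967), Ch. XV, §4.2,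
  Lemma 4.2.2, PDF p. 360 [CasselsFrohlichANT1967].
* C. Moeglin, J.-L. Waldspurger, *Spectral decomposition and Eisenstein series* (1995), I.2.10,
  (2)–(3) [MoeglinWaldspurger1995].
-/

noncomputable section

open _root_.MeasureTheory _root_.MeasureTheory.Measure Set Filter IsDedekindDomain NumberField
open _root_.Topology
open scoped ENNReal ComplexConjugate Classical

namespace Literature.NumberTheory.Automorphic

section Inversion

variable (K : Type) [Field K] [NumberField K]
  [MeasurableSpace (adeleQuotient K)] [BorelSpace (adeleQuotient K)]

omit [MeasurableSpace (adeleQuotient K)] [BorelSpace (adeleQuotient K)] in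
/-- `|ψ_ξ(u)| = 1`. [folklore] -/
theorem norm_adeleQuotChar (ξ : K) (u : adeleQuotient K) : ‖(adeleQuotChar K ξ u : ℂ)‖ = 1 :=
  Circle.norm_coe _

omit [MeasurableSpace (adeleQuotient K)] [BorelSpace (adeleQuotient K)] in
/-- **A Fourier series with absolutely summable coefficients is continuous**:
`u ↦ ∑_ξ c_ξ ψ_ξ(u)` for `∑_ξ |c_ξ| < ∞` (uniform convergence, `|ψ_ξ| = 1`).
[cite: CasselsFrohlichANT1967, Ch. XV Lemma 4.2.2] -/
theorem continuous_tsum_mul_adeleQuotChar {c : K → ℂ} (hc : Summable fun ξ => ‖c ξ‖) :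
    Continuous fun u : adeleQuotient K => ∑' ξ : K, c ξ * (adeleQuotChar K ξ u : ℂ) := by
  refine continuous_tsum (fun ξ => continuous_const.mul (continuous_adeleQuotChar K ξ)) hc ?_
  intro ξ u
  rw [norm_mul, norm_adeleQuotChar, mul_one]

/-- **The coefficients of a Fourier series**: for `∑_ξ |c_ξ| < ∞`,
`∫ conj ψ_η(u) (∑_ξ c_ξ ψ_ξ(u)) du = c_η` (interchange of sum and integral, orthogonality of the
distinct characters `ψ_ξ`). [cite: CasselsFrohlichANT1967, Ch. XV Lemma 4.2.2] -/
theorem integral_conj_adeleQuotChar_mul_tsum {c : K → ℂ} (hc : Summable fun ξ => ‖c ξ‖) (η : K) :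
    ∫ u, conj (adeleQuotChar K η u : ℂ) * ∑' ξ : K, c ξ * (adeleQuotChar K ξ u : ℂ)
      ∂(adeleQuotHaar K) = c η := by
  classical
  haveI : Countable K := NumberField.countable' (K := K)
  have h1 : ∀ u : adeleQuotient K,
      conj (adeleQuotChar K η u : ℂ) * ∑' ξ : K, c ξ * (adeleQuotChar K ξ u : ℂ) =
        ∑' ξ : K, c ξ * (conj (adeleQuotChar K η u : ℂ) * (adeleQuotChar K ξ u : ℂ)) := by
    intro u
    rw [← tsum_mul_left]
    exact tsum_congr fun ξ => by ring
  simp_rw [h1]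
  have hmeas : ∀ ξ : K, AEStronglyMeasurable
      (fun u : adeleQuotient K => c ξ * (conj (adeleQuotChar K η u : ℂ) * (adeleQuotChar K ξ u : ℂ)))
      (adeleQuotHaar K) := fun ξ =>
    (continuous_const.mul (((Complex.continuous_conj.comp (continuous_adeleQuotChar K η))).mul
      (continuous_adeleQuotChar K ξ))).aestronglyMeasurable
  have hnorm : ∀ (ξ : K) (u : adeleQuotient K),
      ‖c ξ * (conj (adeleQuotChar K η u : ℂ) * (adeleQuotChar K ξ u : ℂ))‖ = ‖c ξ‖ := by
    intro ξ u
    rw [norm_mul, norm_mul, Complex.norm_conj, norm_adeleQuotChar, norm_adeleQuotChar, mul_one,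
      mul_one]
  rw [integral_tsum hmeas]
  · have h2 : ∀ ξ : K, ∫ u, c ξ * (conj (adeleQuotChar K η u : ℂ) * (adeleQuotChar K ξ u : ℂ))
        ∂(adeleQuotHaar K) = if ξ = η then c ξ else 0 := by
      intro ξ
      rw [integral_const_mul, integral_conj_addChar_mul_addChar]
      by_cases h : ξ = η
      · subst h
        simp
      · have hne : adeleQuotChar K η ≠ adeleQuotChar K ξ := fun h' =>
          h ((adeleQuotChar_injective K) h').symm
        rw [if_neg hne, if_neg h, mul_zero]
    simp_rw [h2]
    exact tsum_ite_eq η c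
  · have h3 : ∀ ξ : K, ∫⁻ u, ‖c ξ * (conj (adeleQuotChar K η u : ℂ) * (adeleQuotChar K ξ u : ℂ))‖ₑ
        ∂(adeleQuotHaar K) = ENNReal.ofReal ‖c ξ‖ := by
      intro ξ
      have : ∀ u : adeleQuotient K,
          ‖c ξ * (conj (adeleQuotChar K η u : ℂ) * (adeleQuotChar K ξ u : ℂ))‖ₑ =
            ENNReal.ofReal ‖c ξ‖ := fun u => by
        rw [← ofReal_norm, hnorm]
      simp_rw [this]
      rw [lintegral_const, measure_univ, mul_one]
    simp_rw [h3]
    rw [← ENNReal.ofReal_tsum_of_nonneg (fun ξ => norm_nonneg _) hc]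
    exact ENNReal.ofReal_ne_top

/-- **Pointwise Fourier inversion on `𝔸_K ⧸ K`**: a continuous `f` with absolutely summable
Fourier coefficients `f̂(ξ) = ∫ conj ψ_ξ(u) f(u) du` is the sum of its Fourier series,
`f(v) = ∑_ξ f̂(ξ) ψ_ξ(v)` for every `v` (the difference is continuous with vanishing coefficients,
hence zero by the completeness of the characters, `K^⊥ = K`). Tate's Lemma 4.2.2 for `𝔸_K ⧸ K`.
[cite: CasselsFrohlichANT1967, Ch. XV Lemma 4.2.2] -/
theorem eq_tsum_integral_mul_adeleQuotChar {f : adeleQuotient K → ℂ} (hf : Continuous f)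
    (hsum : Summable fun ξ : K =>
      ‖∫ u, conj (adeleQuotChar K ξ u : ℂ) * f u ∂(adeleQuotHaar K)‖)
    (v : adeleQuotient K) :
    f v = ∑' ξ : K, (∫ u, conj (adeleQuotChar K ξ u : ℂ) * f u ∂(adeleQuotHaar K)) *
      (adeleQuotChar K ξ v : ℂ) := by
  set c : K → ℂ := fun ξ => ∫ u, conj (adeleQuotChar K ξ u : ℂ) * f u ∂(adeleQuotHaar K) with hc
  set g : adeleQuotient K → ℂ := fun u => ∑' ξ : K, c ξ * (adeleQuotChar K ξ u : ℂ) with hg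
  have hgc : Continuous g := continuous_tsum_mul_adeleQuotChar K hsum
  have hint : ∀ η : K, Integrable (fun u => conj (adeleQuotChar K η u : ℂ) * f u) (adeleQuotHaar K) :=
    fun η => ((Complex.continuous_conj.comp (continuous_adeleQuotChar K η)).mul
      hf).integrable_of_hasCompactSupport (HasCompactSupport.of_compactSpace _)
  have hintg : ∀ η : K, Integrable (fun u => conj (adeleQuotChar K η u : ℂ) * g u) (adeleQuotHaar K) :=
    fun η => ((Complex.continuous_conj.comp (continuous_adeleQuotChar K η)).mul
      hgc).integrable_of_hasCompactSupport (HasCompactSupport.of_compactSpace _)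
  have hfg : f - g = 0 := by
    refine eq_zero_of_forall_integral_conj_adeleQuotChar_mul_eq_zero K (hf.sub hgc) fun η => ?_
    simp only [Pi.sub_apply, mul_sub]
    rw [integral_sub (hint η) (hintg η), integral_conj_adeleQuotChar_mul_tsum K hsum η, sub_self]
  have h := congr_fun hfg v
  rw [Pi.sub_apply, Pi.zero_apply, sub_eq_zero] at h
  exact h

/-- **Inversion at the origin**: `f(0) = ∑_ξ f̂(ξ)` for `f` continuous with `∑ |f̂(ξ)| < ∞`.
[cite: CasselsFrohlichANT1967, Ch. XV Lemma 4.2.2] -/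
theorem apply_zero_eq_tsum_integral {f : adeleQuotient K → ℂ} (hf : Continuous f)
    (hsum : Summable fun ξ : K =>
      ‖∫ u, conj (adeleQuotChar K ξ u : ℂ) * f u ∂(adeleQuotHaar K)‖) :
    f 0 = ∑' ξ : K, ∫ u, conj (adeleQuotChar K ξ u : ℂ) * f u ∂(adeleQuotHaar K) := by
  rw [eq_tsum_integral_mul_adeleQuotChar K hf hsum 0]
  exact tsum_congr fun ξ => by rw [AddChar.map_zero_eq_one, Circle.coe_one, mul_one]

/-- The `0`-th Fourier coefficient is the integral (`ψ₀ = 1`). [folklore] -/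
theorem integral_conj_adeleQuotChar_zero_mul (f : adeleQuotient K → ℂ) :
    ∫ u, conj (adeleQuotChar K 0 u : ℂ) * f u ∂(adeleQuotHaar K) = ∫ u, f u ∂(adeleQuotHaar K) := by
  refine integral_congr_ae (Eventually.of_forall fun u => ?_)
  have h0 : adeleQuotChar K 0 = 0 := map_zero (adeleQuotCharHom K)
  simp only [h0, AddChar.zero_apply, Circle.coe_one, map_one, one_mul]

/-- **A function minus its constant term is the sum of its non-trivial Fourier coefficients**:
`f(0) - ∫ f = ∑_{ξ ≠ 0} f̂(ξ)` for `f` continuous on `𝔸_K ⧸ K` with `∑ |f̂(ξ)| < ∞`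
(Moeglin–Waldspurger I.2.10 (3), one variable). [cite: MoeglinWaldspurger1995, I.2.10 (3)] -/
theorem apply_zero_sub_integral_eq_tsum {f : adeleQuotient K → ℂ} (hf : Continuous f)
    (hsum : Summable fun ξ : K =>
      ‖∫ u, conj (adeleQuotChar K ξ u : ℂ) * f u ∂(adeleQuotHaar K)‖) :
    f 0 - ∫ u, f u ∂(adeleQuotHaar K) =
      ∑' ξ : K, if ξ = 0 then 0 else ∫ u, conj (adeleQuotChar K ξ u : ℂ) * f u ∂(adeleQuotHaar K) := by
  classical
  have hs : Summable fun ξ : K => ∫ u, conj (adeleQuotChar K ξ u : ℂ) * f u ∂(adeleQuotHaar K) :=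
    hsum.of_norm
  rw [apply_zero_eq_tsum_integral K hf hsum, hs.tsum_eq_add_tsum_ite 0,
    integral_conj_adeleQuotChar_zero_mul, add_sub_cancel_left]

/-- **Bound for a function minus its constant term**: `‖f(0) - ∫ f‖ ≤ ∑_{ξ ≠ 0} |f̂(ξ)|`.
[cite: MoeglinWaldspurger1995, I.2.10 (3)] -/
theorem norm_apply_zero_sub_integral_le_tsum {f : adeleQuotient K → ℂ} (hf : Continuous f)
    (hsum : Summable fun ξ : K =>
      ‖∫ u, conj (adeleQuotChar K ξ u : ℂ) * f u ∂(adeleQuotHaar K)‖) :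
    ‖f 0 - ∫ u, f u ∂(adeleQuotHaar K)‖ ≤
      ∑' ξ : K, if ξ = 0 then 0 else ‖∫ u, conj (adeleQuotChar K ξ u : ℂ) * f u ∂(adeleQuotHaar K)‖ := by
  classical
  rw [apply_zero_sub_integral_eq_tsum K hf hsum]
  have hle : ∀ ξ : K, ‖(if ξ = 0 then (0 : ℂ) else
      ∫ u, conj (adeleQuotChar K ξ u : ℂ) * f u ∂(adeleQuotHaar K))‖ ≤
        if ξ = 0 then 0 else ‖∫ u, conj (adeleQuotChar K ξ u : ℂ) * f u ∂(adeleQuotHaar K)‖ := by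
    intro ξ
    split_ifs <;> simp
  have hsum' : Summable fun ξ : K =>
      if ξ = 0 then (0 : ℝ) else ‖∫ u, conj (adeleQuotChar K ξ u : ℂ) * f u ∂(adeleQuotHaar K)‖ := by
    refine hsum.of_nonneg_of_le (fun ξ => ?_) (fun ξ => ?_)
    · split_ifs <;> simp
    · split_ifs <;> simp
  have hsum'' : Summable fun ξ : K => ‖(if ξ = 0 then (0 : ℂ) else
      ∫ u, conj (adeleQuotChar K ξ u : ℂ) * f u ∂(adeleQuotHaar K))‖ :=
    hsum'.of_nonneg_of_le (fun ξ => norm_nonneg _) hle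
  exact (norm_tsum_le_tsum_norm hsum'').trans (hsum''.tsum_le_tsum hle hsum')

/-- **Translation covariance of the Fourier coefficients**: for `w ∈ 𝔸_K ⧸ K`,
`∫ conj ψ_ξ(u) f(u + w) du = ψ_ξ(w) ∫ conj ψ_ξ(u) f(u) du` (invariance of the Haar measure under
`u ↦ u + w` and `ψ_ξ(u - w) = ψ_ξ(u) ψ_ξ(w)⁻¹`). This is the identity differentiated in the
integration by parts of Moeglin–Waldspurger I.2.10. [cite: MoeglinWaldspurger1995, I.2.10] -/
theorem integral_conj_adeleQuotChar_mul_comp_add (f : adeleQuotient K → ℂ) (ξ : K)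
    (w : adeleQuotient K) :
    ∫ u, conj (adeleQuotChar K ξ u : ℂ) * f (u + w) ∂(adeleQuotHaar K) =
      (adeleQuotChar K ξ w : ℂ) * ∫ u, conj (adeleQuotChar K ξ u : ℂ) * f u ∂(adeleQuotHaar K) := by
  have h := integral_add_right_eq_self (μ := adeleQuotHaar K)
    (fun u => conj (adeleQuotChar K ξ (u - w) : ℂ) * f u) w
  simp only [add_sub_cancel_right] at h
  rw [h, ← integral_const_mul]
  refine integral_congr_ae (Eventually.of_forall fun u => ?_)
  simp only
  rw [sub_eq_add_neg, AddChar.map_add_eq_mul, AddChar.map_neg_eq_inv, Circle.coe_mul, map_mul,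
    Circle.coe_inv_eq_conj, Complex.conj_conj]
  ring

end Inversion

end Literature.NumberTheory.Automorphic
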